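import Summits.QuantumFields.YangMills.Theorems.BalabanUVNodesN20HellingerRoadCapstone

/-!
# BalabanUVNodes ∕ node N20 (NE7b) — (R‑c) IS NO LETTER FOR A BOUNDED SOURCE CURRENT: the one-run susceptibility input of the hellinger road's endpoint response is
# discharged by `|∂_t A_τ| ≤ M·A_τ` (a bounded conditional mean of the source observable), and the capstone re-stated with that letter

Cell `pub-ymgap` (HUMAN RULING D-0062 Track A ∕ director-ym R399 (3a) second-wave width seats), WIDTH SEAT `pub-ymgap-dag-n20-w5` (node n20 = NE7b),
generation g4, CLAIM-3 ∕ INTENT-4 (bus; continuation of CLAIM-2's capstone lineage).  Key item K3⁷ `SpineGivenEndpointR13SepCoPH` (stmt-QuantumFields-20544; skeleton of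
record v5 941dddb108cbaacf, stub 2 `stub_expansion13H`); filed `--kind proof --supports … --as helper`.  COUNT-NEUTRAL.  THEOREMS ONLY (0 `def`, 0 `instance`, 0 `notation`,
0 `sorry`).  ADDITIVE — imports this seat's `…N20HellingerRoadCapstone` ONLY (`exists_hybridNE7_of_endpointLetters_noHead` BY NAME); modifies nothing.

WHY.  After the capstone the hellinger road's letter list at a key reads: (V‑a)'s residue ((KR‑dc), (PEND), positions, births — dag-n19-w4 g7), (KR) tame tilts, (V‑b) = (YG)
radii, the regime; and on the R-side (R′) `|E_{q_{K,s}}[B'∕B − A'∕A]| ≤ R₁ K` with `Σ R₁ < ∞` (two-run, THE unprinted first-moment letter) and (R‑c) `Σ_T ½(p+q)(A'∕A − m_{K,s})² ≤ χ`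
(a one-run source susceptibility of the run-A CURRENT `j = A'∕A = ∂_s log A_τ` under the mixture of the two class laws).  (R‑c) is the one R-side letter that is STRUCTURAL:
if each class weight is a positive superposition of source-tilted Boltzmann factors `e^{s·𝒲}` of a BOUNDED source observable `|𝒲| ≤ M` (Wilson loop traces are bounded), then
`j_τ(s)` is a conditional mean of `𝒲` and `|j_τ| ≤ M` — in letters, `|A' K s τ| ≤ M·A K s τ`.  THIS FILE cashes that:
* §1 [folklore] ★ `mixtureCurrentMoment_le_sq_of_boundedCurrent` — positive weights `A, B`, derivative carrier `A'` with `|A' τ| ≤ M·A τ` on `T` ⇒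
  `Σ_T ½(p+q)·(A'∕A − 0)² ≤ M²` (each squared current `≤ M²`, the mixture law has mass one); `abs_logDeriv_le_of_tilted` — the SHAPE behind the letter: for a finite positive
  superposition `A(s) = Σ_c κ_c e^{s w_c}` with `|w_c| ≤ M`, `|A'(s)| ≤ M·A(s)`.
* §2 ★★★ `exists_hybridNE7_of_endpointLetters_boundedCurrent` — the capstone's road form (`…_noHead`) with (R‑c) REPLACED by the bounded-current letter (`χ := M²`, centring `0`):
  (H) + `Σ√η < ∞` + (R′) + `|A'| ≤ M·A` ⇒ `∃ Wsh shA shB, … ∧ HybridNE7 … Wsh (K ↦ l₀·(R₁ K + 2√(2η_K)·M)∕vol)` (`√(M²) = M` folded); ★★ `…_of_affinityDefectLetter_response_boundedCurrent`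
  (any (H) supplier in the ∃-shape — p618979 ∕ p620730 ∕ this seat's p622199 `affinityDefectLetter_of_refreshProcesses_and_tameTilts` ∕ dag-n20-w4's and dag-n19-w4 g7's editions —
  so the refresh-process capstone with a bounded current is ONE `obtain` away and is not re-typed here).
* §3 toy (A6): a two-configuration superposition with `w = ±1` has `|A'| ≤ 1·A`.
READING (located, nothing proposed).  (i) (R′) is untouched and remains the road's two-run first-moment letter; with `|A'∕A|, |B'∕B| ≤ M` it is implied by the class-law TV
letter only up to `2M·TV`, which is `O(√η_K)` — summable but NOT what makes `δ_K` small relative to the target; (R′) asks the two runs' CONDITIONAL MEANS to agree class by class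
under `q`, a genuinely two-run statement.  (ii) For Bałaban's generating functions the source enters the action linearly against a bounded loop functional, so the
superposition shape of §1 is the expected one at configuration level; at CLASS level it is a hypothesis here (produced by nobody).

HONEST FRAMING.  [folklore] finite-sum real analysis + by-name transfer through `…N20HellingerRoadCapstone` (hence p619159, p609004, p622199, p618979); the bounded-current
letter, (H)'s suppliers' letters and (R′) are HYPOTHESES produced by nobody — (R′), (V‑b) UNPRINTED for d = 4; NO estimate of Bałaban's programme is proved; nothing of Bałaban's
asserted or instantiated (no `Provisos₁₃CoPH` tuple — K0⁷ OPEN); NE7 ∕ NE7b ∕ NE7c NOT PRINTED as two-run statements for d = 4 and NOT proved; N19 ∕ N20 ∕ N21 NOT discharged; K3⁷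
OPEN, v5 STANDS, not claimed; no summit statement is proved by this seat; counts UNMOVED (typed 28∕28 · discharged 5∕27, A 5∕28).  One finite four-torus programme at fixed ε —
NOT ℝ⁴, NOT infinite volume, NOT OS, NOT a mass gap, NOT the Clay problem (R4 closes the conditional finite-𝕋⁴ rung `BalabanLadder.UV` only).  0 `def`; 0 `sorry`; standard axioms.
-/

noncomputable section

namespace Summit.QuantumFields.YangMills.BalabanUVNodes.N20HellingerRoadBoundedCurrent

open Finset
open Literature.MathematicalPhysics.QuantumFieldTheory.Balaban1983to89
open T4MatchingAssembly (HybridNE7)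
open Summit.QuantumFields.YangMills.BalabanUVNodes.N20HellingerRoadCapstone (exists_hybridNE7_of_endpointLetters_noHead)

variable {ι : Type*}

/-! ## §1 A bounded source current pays (R‑c) [folklore] -/

section Current
variable {T : Finset ι} {A B A' : ι → ℝ} {M : ℝ}

/-- **★ (R‑c) FROM A BOUNDED CURRENT** [folklore].  Positive class weights `A, B` on `T` (positive totals) and a derivative carrier `A'` with `|A' τ| ≤ M·A τ` on `T` ⇒ the
mixture second moment of the run-A source current about `0` is at most `M²`:  `Σ_T ((A∕Σ A + B∕Σ B)∕2)·(A'∕A − 0)² ≤ M²`. -/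
theorem mixtureCurrentMoment_le_sq_of_boundedCurrent (hA : ∀ τ ∈ T, 0 < A τ) (hB : ∀ τ ∈ T, 0 < B τ)
    (hZA : 0 < ∑ τ ∈ T, A τ) (hZB : 0 < ∑ τ ∈ T, B τ) (hcur : ∀ τ ∈ T, |A' τ| ≤ M * A τ) :
    ∑ τ ∈ T, (A τ / (∑ σ ∈ T, A σ) + B τ / (∑ σ ∈ T, B σ)) / 2 * (A' τ / A τ - 0) ^ 2 ≤ M ^ 2 := by
  have hsq : ∀ τ ∈ T, (A' τ / A τ - 0) ^ 2 ≤ M ^ 2 := by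
    intro τ hτ
    have hAτ := hA τ hτ
    have h1 : |A' τ / A τ| ≤ M := by
      rw [abs_div, abs_of_pos hAτ, div_le_iff₀ hAτ]
      exact hcur τ hτ
    have hM : 0 ≤ M := (abs_nonneg _).trans h1
    rw [sub_zero, ← sq_abs]
    exact pow_le_pow_left₀ (abs_nonneg _) h1 2
  have hw : ∀ τ ∈ T, 0 ≤ (A τ / (∑ σ ∈ T, A σ) + B τ / (∑ σ ∈ T, B σ)) / 2 := fun τ hτ => by
    have := (hA τ hτ).le; have := (hB τ hτ).le; positivity
  have hmass : ∑ τ ∈ T, (A τ / (∑ σ ∈ T, A σ) + B τ / (∑ σ ∈ T, B σ)) / 2 = 1 := by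
    rw [← sum_div, sum_add_distrib, ← sum_div, ← sum_div, div_self hZA.ne', div_self hZB.ne']
    norm_num
  calc ∑ τ ∈ T, (A τ / (∑ σ ∈ T, A σ) + B τ / (∑ σ ∈ T, B σ)) / 2 * (A' τ / A τ - 0) ^ 2
      ≤ ∑ τ ∈ T, (A τ / (∑ σ ∈ T, A σ) + B τ / (∑ σ ∈ T, B σ)) / 2 * M ^ 2 :=
        sum_le_sum fun τ hτ => mul_le_mul_of_nonneg_left (hsq τ hτ) (hw τ hτ)
    _ = M ^ 2 := by rw [← sum_mul, hmass, one_mul]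

/-- **THE SHAPE BEHIND THE LETTER** [folklore].  A finite positive superposition of source-tilted factors `A(s) = Σ_{c∈C} κ_c·e^{s·w_c}` of a BOUNDED observable `|w_c| ≤ M`
has derivative `A'(s) = Σ κ_c w_c e^{s w_c}` with `|A'(s)| ≤ M·A(s)` — the current `A'∕A` is a conditional mean of `w`. -/
theorem abs_deriv_le_of_tilted {γ : Type*} (C : Finset γ) (κ w : γ → ℝ) (hκ : ∀ c ∈ C, 0 ≤ κ c) (hw : ∀ c ∈ C, |w c| ≤ M) (s : ℝ) :
    HasDerivAt (fun u => ∑ c ∈ C, κ c * Real.exp (u * w c)) (∑ c ∈ C, κ c * w c * Real.exp (s * w c)) s ∧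
      |∑ c ∈ C, κ c * w c * Real.exp (s * w c)| ≤ M * ∑ c ∈ C, κ c * Real.exp (s * w c) := by
  constructor
  · have : ∀ c ∈ C, HasDerivAt (fun u => κ c * Real.exp (u * w c)) (κ c * w c * Real.exp (s * w c)) s := by
      intro c _
      have h1 : HasDerivAt (fun u => u * w c) (w c) s := by simpa using (hasDerivAt_id s).mul_const (w c)
      exact ((h1.exp).const_mul (κ c)).congr_deriv (by ring)
    exact HasDerivAt.fun_sum this
  · calc |∑ c ∈ C, κ c * w c * Real.exp (s * w c)| ≤ ∑ c ∈ C, |κ c * w c * Real.exp (s * w c)| := abs_sum_le_sum_abs _ _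
      _ ≤ ∑ c ∈ C, M * (κ c * Real.exp (s * w c)) := sum_le_sum fun c hc => by
          rw [abs_mul, abs_mul, abs_of_nonneg (hκ c hc), abs_of_pos (Real.exp_pos _)]
          have := hw c hc
          have hk := hκ c hc
          nlinarith [Real.exp_pos (s * w c), mul_nonneg hk (Real.exp_pos (s * w c)).le]
      _ = M * ∑ c ∈ C, κ c * Real.exp (s * w c) := by rw [mul_sum]

end Current

/-! ## §2 The road and the capstone with (R‑c) replaced by the bounded-current letter [by-name transfer] -/

section Road
variable [DecidableEq ι] {l₀ vol : ℝ} {T : ℕ → Finset ι} {A B : ℕ → ℝ → ι → ℝ}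

/-- **★★★ THE ENDPOINT ROAD WITH A BOUNDED CURRENT** [folklore + by-name].  `exists_hybridNE7_of_endpointLetters_noHead` with (R‑c) discharged by `|A' K s τ| ≤ M·A K s τ`:
(H) + `Σ√η < ∞` + (R′) with `Σ R₁ < ∞` + bounded current ⇒ `∃ Wsh shA shB, (0 ≤ Wsh ≤ √(2η), Wsh < 1) ∧ HybridNE7 … Wsh (K ↦ l₀·(R₁ K + 2√(2η_K)·M)∕vol)` (`0 ≤ M` is forced
as soon as some class exists; it is assumed, so that `√(M²) = M`). -/
theorem exists_hybridNE7_of_endpointLetters_boundedCurrent (hl₀ : 0 ≤ l₀) (hvol : 0 < vol)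
    (hA : ∀ (K : ℕ) (t : ℝ), |t| ≤ l₀ → ∀ τ ∈ T K, 0 < A K t τ) (hB : ∀ (K : ℕ) (t : ℝ), |t| ≤ l₀ → ∀ τ ∈ T K, 0 < B K t τ)
    (hZA : ∀ (K : ℕ) (t : ℝ), |t| ≤ l₀ → 0 < ∑ τ ∈ T K, A K t τ) (hZB : ∀ (K : ℕ) (t : ℝ), |t| ≤ l₀ → 0 < ∑ τ ∈ T K, B K t τ)
    {Z : ℕ → ℝ → ℝ} (hZA' : ∀ (K : ℕ) (t : ℝ), |t| ≤ l₀ → Z K t = ∑ τ ∈ T K, A K t τ)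
    (hZB' : ∀ (K : ℕ) (t : ℝ), |t| ≤ l₀ → Z (K + 1) t = ∑ τ ∈ T K, B K t τ)
    {A' B' : ℕ → ℝ → ι → ℝ}
    (hdA : ∀ (K : ℕ) (s : ℝ), |s| ≤ l₀ → ∀ τ ∈ T K, HasDerivAt (fun u => A K u τ) (A' K s τ) s)
    (hdB : ∀ (K : ℕ) (s : ℝ), |s| ≤ l₀ → ∀ τ ∈ T K, HasDerivAt (fun u => B K u τ) (B' K s τ) s)
    {η R₁ : ℕ → ℝ} {M : ℝ} (hM : 0 ≤ M)
    (hH : ∀ (K : ℕ) (t : ℝ), |t| ≤ l₀ →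
      1 - ∑ τ ∈ T K, Real.sqrt ((A K t τ / ∑ σ ∈ T K, A K t σ) * (B K t τ / ∑ σ ∈ T K, B K t σ)) ≤ η K)
    (hηs : Summable fun K => Real.sqrt (η K))
    (hR : ∀ (K : ℕ) (s : ℝ), |s| ≤ l₀ →
      |∑ τ ∈ T K, B K s τ / (∑ σ ∈ T K, B K s σ) * (B' K s τ / B K s τ - A' K s τ / A K s τ)| ≤ R₁ K)
    (hRs : Summable R₁)
    (hcur : ∀ (K : ℕ) (s : ℝ), |s| ≤ l₀ → ∀ τ ∈ T K, |A' K s τ| ≤ M * A K s τ) :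
    ∃ (Wsh : ℕ → ℝ) (shA shB : ℕ → ℝ → ι → ℝ),
      (∀ K, 0 ≤ Wsh K ∧ Wsh K ≤ Real.sqrt (2 * η K) ∧ Wsh K < 1) ∧
      HybridNE7 l₀ vol T A B (fun _ _ => ∅) (fun _ => 0) shA shB Wsh
        (fun K => l₀ * (R₁ K + 2 * Real.sqrt (2 * η K) * M) / vol) := by
  have hχ : ∀ (K : ℕ) (s : ℝ), |s| ≤ l₀ →
      ∑ τ ∈ T K, (A K s τ / (∑ σ ∈ T K, A K s σ) + B K s τ / (∑ σ ∈ T K, B K s σ)) / 2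
        * (A' K s τ / A K s τ - (fun (_ : ℕ) (_ : ℝ) => (0:ℝ)) K s) ^ 2 ≤ M ^ 2 :=
    fun K s hs => mixtureCurrentMoment_le_sq_of_boundedCurrent (hA K s hs) (hB K s hs) (hZA K s hs) (hZB K s hs) (hcur K s hs)
  have h := exists_hybridNE7_of_endpointLetters_noHead hl₀ hvol hA hB hZA hZB hZA' hZB' hdA hdB hH hηs hR hRs hχ
  rwa [Real.sqrt_sq hM] at h

/-- **★★ FROM ANY (H) SUPPLIER, WITH A BOUNDED CURRENT** [folklore + by-name]. -/
theorem exists_hybridNE7_of_affinityDefectLetter_response_boundedCurrent (hl₀ : 0 ≤ l₀) (hvol : 0 < vol)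
    (hA : ∀ (K : ℕ) (t : ℝ), |t| ≤ l₀ → ∀ τ ∈ T K, 0 < A K t τ) (hB : ∀ (K : ℕ) (t : ℝ), |t| ≤ l₀ → ∀ τ ∈ T K, 0 < B K t τ)
    (hZA : ∀ (K : ℕ) (t : ℝ), |t| ≤ l₀ → 0 < ∑ τ ∈ T K, A K t τ) (hZB : ∀ (K : ℕ) (t : ℝ), |t| ≤ l₀ → 0 < ∑ τ ∈ T K, B K t τ)
    {Z : ℕ → ℝ → ℝ} (hZA' : ∀ (K : ℕ) (t : ℝ), |t| ≤ l₀ → Z K t = ∑ τ ∈ T K, A K t τ)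
    (hZB' : ∀ (K : ℕ) (t : ℝ), |t| ≤ l₀ → Z (K + 1) t = ∑ τ ∈ T K, B K t τ)
    {A' B' : ℕ → ℝ → ι → ℝ}
    (hdA : ∀ (K : ℕ) (s : ℝ), |s| ≤ l₀ → ∀ τ ∈ T K, HasDerivAt (fun u => A K u τ) (A' K s τ) s)
    (hdB : ∀ (K : ℕ) (s : ℝ), |s| ≤ l₀ → ∀ τ ∈ T K, HasDerivAt (fun u => B K u τ) (B' K s τ) s)
    (hHex : ∃ η : ℕ → ℝ, (∀ K, 0 ≤ η K) ∧ Summable (fun K => Real.sqrt (η K)) ∧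
      ∀ (K : ℕ) (t : ℝ), |t| ≤ l₀ →
        1 - ∑ τ ∈ T K, Real.sqrt ((A K t τ / ∑ σ ∈ T K, A K t σ) * (B K t τ / ∑ σ ∈ T K, B K t σ)) ≤ η K)
    {R₁ : ℕ → ℝ} {M : ℝ} (hM : 0 ≤ M)
    (hR : ∀ (K : ℕ) (s : ℝ), |s| ≤ l₀ →
      |∑ τ ∈ T K, B K s τ / (∑ σ ∈ T K, B K s σ) * (B' K s τ / B K s τ - A' K s τ / A K s τ)| ≤ R₁ K)
    (hRs : Summable R₁)
    (hcur : ∀ (K : ℕ) (s : ℝ), |s| ≤ l₀ → ∀ τ ∈ T K, |A' K s τ| ≤ M * A K s τ) :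
    ∃ (η Wsh : ℕ → ℝ) (shA shB : ℕ → ℝ → ι → ℝ),
      (∀ (K : ℕ) (t : ℝ), |t| ≤ l₀ →
        1 - ∑ τ ∈ T K, Real.sqrt ((A K t τ / ∑ σ ∈ T K, A K t σ) * (B K t τ / ∑ σ ∈ T K, B K t σ)) ≤ η K) ∧
      Summable (fun K => Real.sqrt (η K)) ∧
      (∀ K, 0 ≤ Wsh K ∧ Wsh K ≤ Real.sqrt (2 * η K) ∧ Wsh K < 1) ∧
      HybridNE7 l₀ vol T A B (fun _ _ => ∅) (fun _ => 0) shA shB Wsh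
        (fun K => l₀ * (R₁ K + 2 * Real.sqrt (2 * η K) * M) / vol) := by
  obtain ⟨η, _, hηs, hH⟩ := hHex
  obtain ⟨Wsh, shA, shB, hW, hNE7⟩ := exists_hybridNE7_of_endpointLetters_boundedCurrent hl₀ hvol hA hB hZA hZB hZA' hZB'
    hdA hdB hM hH hηs hR hRs hcur
  exact ⟨η, Wsh, shA, shB, hH, hηs, hW, hNE7⟩

end Road

/-! ## §3 Toy (A6) -/

/-- [toy] The two-configuration superposition `A(s) = e^{s} + e^{−s}` (`κ ≡ 1`, `w = ±1`, `M = 1`) has `|A'(s)| ≤ 1·A(s)` — §1's shape lemma, non-vacuously. -/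
theorem toy_twoConfigurations (s : ℝ) :
    |∑ c ∈ ({0, 1} : Finset ℕ), (1:ℝ) * (if c = 0 then 1 else -1) * Real.exp (s * (if c = 0 then 1 else -1))|
      ≤ 1 * ∑ c ∈ ({0, 1} : Finset ℕ), (1:ℝ) * Real.exp (s * (if c = 0 then 1 else -1)) :=
  (abs_deriv_le_of_tilted ({0, 1} : Finset ℕ) (fun _ => (1:ℝ)) (fun c => if c = 0 then 1 else -1)
    (fun _ _ => zero_le_one) (fun c _ => by split_ifs <;> simp) s).2

end Summit.QuantumFields.YangMills.BalabanUVNodes.N20HellingerRoadBoundedCurrent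

end
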